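import Summits.RiemannHypothesis.RiemannHypothesis.Theorems.GapsEvoDoorsWindowCriterion
import Summits.RiemannHypothesis.RiemannHypothesis.Theses.GapsEvoDoors

/-!
# GapsEvoDoors — item 23032 `FloorSpacingCriterionAll`: the floor-fragment spacing criterion

Item stmt-RiemannHypothesis-23032 of route GapsEvoDoors (cell rh-gaps, LINE L11-a3; analytic
support of the SECOND registered skeleton on crux `FragmentToCI`): for every floor level `f₀` and
window `Δ ≥ 1`, if eventually `F(α, T) ≥ f₀ − ε` on `1 < |α| ≤ Δ` (every `ε > 0`) and RH holds,
then every `λ > 0`, every `0 ≤ f < f₀` and every admissible `r` (even, continuous, `L¹`, `r̂ ∈ L¹`,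
`r ≤ 1`, `r ≤ 0` off `[−λ, λ]`, `r̂ ≥ 0` for `|α| ≥ Δ`) with `r̂ ≥ 0` on `1 ≤ |α| ≤ Δ` and floor
certificate `c_fl(r; Δ, f) = r̂(0) − 1 + 2∫₀¹ α r̂ + 2f ∫₁^Δ r̂ > 0` force `SpacingDensityPos λ`
(a positive proportion of spacings `≤ 2πλ/log T`).

PROOF: the window criterion `GapsEvoDoorsWindow.spacingDensityPos_window` (Bui–Goldston–
Milinovich–Montgomery 2023 Proposition 1 / Theorem 3 with a window minorant) with the minorant
`m = f · r̂`: with `ε := f₀ − f > 0` the floor gives `F ≥ f` on the window, and `r̂ ≥ 0` there, so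
`f r̂ ≤ F r̂`. Together with the tree theorem `DeltaCIFloorNineTenths_holds`
(`GapsEvoDoorsDeltaCIFloorNineTenths.lean`) this leaves the bridge `SpacingToCI` (item 22423) as
the only open stub of the floor skeleton of `FragmentToCI`. RH and the floor fragment are
HYPOTHESES; nothing here bears on the truth of RH.
-/

noncomputable section

open Filter Set MeasureTheory Real

set_option linter.dupNamespace false  -- the mandated namespace repeats `RiemannHypothesis`

namespace Summit.RiemannHypothesis.RiemannHypothesis.Theorems.GapsEvoDoorsWindow

open Literature.NumberTheory.LFunctions Literature.NumberTheory.LFunctions.BGMM2023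

/-- **Item stmt-RiemannHypothesis-23032 (`FloorSpacingCriterionAll`) holds**: the floor fragment
`F ≥ f₀ − o(1)` on `1 < |α| ≤ Δ`, RH and a positive floor certificate at `f < f₀` give a positive
proportion of spacings `≤ 2πλ/log T` — the window criterion with minorant `m = f·r̂`. -/
theorem FloorSpacingCriterionAll_holds :
    Summit.RiemannHypothesis.RiemannHypothesis.Theses.GapsEvoDoors.FloorSpacingCriterionAll := by
  unfold Summit.RiemannHypothesis.RiemannHypothesis.Theses.GapsEvoDoors.FloorSpacingCriterionAll
  intro f₀ Δ hΔ hfloor hRH lam f r hlam hf hf0 hev hco hin hti hle hno htail hwnn hc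
  have hge : ∀ a, cosTransform r (-a) = cosTransform r a := cosTransform_neg r
  have hgc : Continuous (cosTransform r) := continuous_cosTransform hev hin
  obtain ⟨T₀, hT₀⟩ := hfloor (f₀ - f) (by linarith)
  refine spacingDensityPos_window hRH hlam hΔ hev hco hin hti hle hno htail
    (m := fun a ↦ f * cosTransform r a) (continuous_const.mul hgc) (fun a ↦ by simp only [hge])
    ⟨T₀, fun T hT α h1 h2 ↦ ?_⟩ ?_
  · have hF : f ≤ montgomeryFormFactor α T := by linarith [hT₀ T hT α h1 h2]
    exact mul_le_mul_of_nonneg_right hF (hwnn α h1.le h2)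
  · have e : (∫ a in (1 : ℝ)..Δ, f * cosTransform r a) = f * ∫ a in (1 : ℝ)..Δ, cosTransform r a :=
      intervalIntegral.integral_const_mul _ _
    rw [e, ← mul_assoc]
    exact hc

end Summit.RiemannHypothesis.RiemannHypothesis.Theorems.GapsEvoDoorsWindow

end
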